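import Literature.NumberTheory.DiophantineGeometry.AbcWave0
import HarnessLib

/-!
# Crux `Target` (stmt-ABC-2159, route ABC/FeketeScales) — NEGATIVE LEMMA:
# no linearly good scales (`δ = 0` fails even in the SPARSE form of conjunct 2)

Conjunct 2 of the crux (`SparseGoodScales`) asks, for every `δ > 0`, for arbitrarily large scales `R`
with `c ≤ R^{1+δ}` for every abc triple of radical `≤ R`.  Here: the `δ = 0` version is false with ANY
constant and even along ANY sequence of scales — `exists_triple_linear_excess`: for every real `C` and
all large `R` there is an abc triple with `rad(abc) ≤ R` and `c > C·R`, i.e. `lim inf_R G(R)/R = +∞` for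
the extremal height `G(R) = max{c : rad(abc) ≤ R}` (Granville–Tucker's `2^{p(p−1)}` example and the
Stewart–Tijdeman families give this only for SOME scales).  Construction (2-adic discrete logarithm,
elementary): modulo `2^{k+2}` every `x ≡ 1 (mod 4)` is a power `5^e`, `e < 2^k`
(`exists_pow_five_of_four_dvd`, from the exact lifting `5^{2^j} = 1 + 2^{j+2} + 2^{j+3} t`,
`five_pow_two_pow_eq`); so for EVERY `i > 2^k` the triple `(5^e, 9^i − 5^e, 9^i)` has `2^{k+2} ∣ b`, hence
`rad(abc) ≤ 30 c / 2^{k+2}`, while its height `c = 9^i` runs through a geometric progression of ratio 9: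
choosing `2^{k+2} ≥ 270 C` the windows `[rad, c/C)` of consecutive members overlap and cover every large
scale.  Consequence `not_sparseGoodScales_exponent_one`: the statement
`∃ C, ∀ N, ∃ R ≥ N, ∀ abc, rad ≤ R → c ≤ C R` is false — the `δ > 0` of conjunct 2 is load-bearing in the
strongest sense.  No definitions. [cite: GranvilleTucker2002, p. 1227] [cite: BombieriGubler2006, Ex. 12.4.13]
-/

set_option linter.dupNamespace false

namespace Summit.ABC.ABC.Theorems.Target.Negative

open Literature.NumberTheory.DiophantineGeometry UniqueFactorizationMonoid Finset

/-- Exact 2-adic lifting of `5`: `5^{2^j} = 1 + 2^{j+2} + 2^{j+3}·t`. [folklore] -/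
theorem five_pow_two_pow_eq (j : ℕ) : ∃ t : ℕ, 5 ^ (2 ^ j) = 1 + 2 ^ (j + 2) + 2 ^ (j + 3) * t := by
  induction j with
  | zero => exact ⟨0, by norm_num⟩
  | succ j ih =>
    obtain ⟨t, ht⟩ := ih
    refine ⟨t + 2 ^ j * (1 + 2 * t) ^ 2, ?_⟩
    rw [pow_succ, pow_mul, ht]
    ring

/-- **2-adic discrete logarithm to base 5.** Every `x ≡ 1 (mod 4)` is congruent to some `5^e`,
`e < 2^k`, modulo `2^{k+2}` (the units `≡ 1 (mod 4)` of `ℤ/2^{k+2}` form the cyclic group generated by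
`5`). [folklore] -/
theorem exists_pow_five_of_four_dvd {x : ℕ} (hx : (4 : ℤ) ∣ (x : ℤ) - 1) (k : ℕ) :
    ∃ e : ℕ, e < 2 ^ k ∧ (2 : ℤ) ^ (k + 2) ∣ (x : ℤ) - 5 ^ e := by
  induction k with
  | zero => exact ⟨0, by norm_num, by simpa using hx⟩
  | succ k ih =>
    obtain ⟨e, he, t, ht⟩ := ih
    rcases Int.even_or_odd t with ⟨s, hs⟩ | ⟨s, hs⟩
    · refine ⟨e, lt_of_lt_of_le he (Nat.pow_le_pow_right two_pos (Nat.le_succ k)), s, ?_⟩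
      rw [ht, hs]; ring
    · obtain ⟨u, hu⟩ := five_pow_two_pow_eq k
      have hu' : ((5 : ℕ) ^ (2 ^ k) : ℤ) = 1 + 2 ^ (k + 2) + 2 ^ (k + 3) * u := by exact_mod_cast hu
      push_cast at hu'
      obtain ⟨v, hv⟩ : Odd ((5 : ℤ) ^ e) := Odd.pow (by decide)
      refine ⟨e + 2 ^ k, by rw [pow_succ]; omega, s - v - (2 * v + 1) * u, ?_⟩
      rw [pow_add]
      linear_combination ht - (5 : ℤ) ^ e * hu' + (2 : ℤ) ^ (k + 2) * hs -
        (2 : ℤ) ^ (k + 2) * (1 + 2 * u) * hv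

/-- The radical of `5^e · b · 9^i` with `2^{k} ∣ b` is at most `30 · b / 2^{k}`. [folklore] -/
theorem radical_triple_le {e i k b : ℕ} (hb : 0 < b) (hkb : 2 ^ k ∣ b) :
    radical (5 ^ e * b * 9 ^ i) * 2 ^ k ≤ 30 * b := by
  obtain ⟨b', hb'⟩ := hkb
  have hb'0 : b' ≠ 0 := by rintro rfl; simp [hb'] at hb
  have h5 : radical ((5 : ℕ) ^ e) ∣ 5 := by
    have := radical_pow_dvd (a := (5 : ℕ)) (n := e)
    rwa [radical_of_prime (Nat.prime_iff.mp Nat.prime_five), normalize_eq] at this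
  have h9 : radical ((9 : ℕ) ^ i) ∣ 3 := by
    have h1 := radical_pow_dvd (a := (9 : ℕ)) (n := i)
    have h2 : radical (9 : ℕ) ∣ 3 := by
      have := radical_pow_dvd (a := (3 : ℕ)) (n := 2)
      rwa [show (3 : ℕ) ^ 2 = 9 by norm_num, radical_of_prime Nat.prime_three.prime, normalize_eq] at this
    exact h1.trans h2
  have h2k : radical ((2 : ℕ) ^ k) ∣ 2 := by
    have := radical_pow_dvd (a := (2 : ℕ)) (n := k)
    rwa [radical_of_prime Nat.prime_two.prime, normalize_eq] at this
  have hbrad : radical b ∣ 2 * b' := by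
    rw [hb']
    exact (radical_mul_dvd (a := 2 ^ k) (b := b')).trans (mul_dvd_mul h2k radical_dvd_self)
  have hdvd : radical (5 ^ e * b * 9 ^ i) ∣ 5 * (2 * b') * 3 :=
    ((radical_mul_dvd (a := 5 ^ e * b) (b := 9 ^ i)).trans
      (mul_dvd_mul ((radical_mul_dvd (a := 5 ^ e) (b := b)).trans (mul_dvd_mul h5 hbrad)) h9))
  have hle : radical (5 ^ e * b * 9 ^ i) ≤ 30 * b' := by
    have := Nat.le_of_dvd (by positivity) hdvd
    linarith
  calc radical (5 ^ e * b * 9 ^ i) * 2 ^ k ≤ 30 * b' * 2 ^ k := Nat.mul_le_mul_right _ hle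
    _ = 30 * b := by rw [hb']; ring

/-- **`lim inf G(R)/R = ∞`: every large scale carries a triple of linear excess `> C`.** For every
real `C` there is `N` such that for every `R ≥ N` some abc triple has `rad(abc) ≤ R` and `c > C·R`
(the triples `(5^e, 9^i − 5^e, 9^i)` with `2^{k+2} ∣ 9^i − 5^e`, `2^{k+2} ≥ 270 C`, `i` minimal with
`9^i > C R`). [cite: GranvilleTucker2002, p. 1227] -/
theorem exists_triple_linear_excess (C : ℝ) :
    ∃ N : ℕ, ∀ R : ℕ, N ≤ R → ∃ a b c : ℕ, IsABCTriple a b c ∧ rad a b c ≤ R ∧ C * R < c := by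
  -- an integer constant `C'' ≥ max(C, 1)` and `k` with `2^{k+2} ≥ 270 C''`
  set C'' : ℕ := ⌈max C 1⌉₊ with hC''
  have hC''1 : 1 ≤ C'' := Nat.ceil_pos.mpr (lt_of_lt_of_le one_pos (le_max_right _ _))
  have hCC'' : C ≤ (C'' : ℝ) := (le_max_left _ _).trans (Nat.le_ceil _)
  set k : ℕ := 270 * C'' with hk
  have hk2 : 270 * C'' ≤ 2 ^ (k + 2) :=
    le_trans (Nat.lt_two_pow_self).le (Nat.pow_le_pow_right two_pos (by omega))
  refine ⟨9 ^ (2 ^ k), fun R hR => ?_⟩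
  have hR1 : 1 ≤ R := le_trans (Nat.one_le_pow _ _ (by norm_num)) hR
  -- the least `i` with `9^i > C'' R`
  have hex : ∃ i : ℕ, C'' * R < 9 ^ i :=
    ⟨C'' * R, lt_of_lt_of_le Nat.lt_two_pow_self (Nat.pow_le_pow_left (by norm_num) _)⟩
  classical
  set i : ℕ := Nat.find hex with hidef
  have hi : C'' * R < 9 ^ i := Nat.find_spec hex
  have hCR : R ≤ C'' * R := Nat.le_mul_of_pos_left R hC''1
  have hi0 : 0 < i := by
    rw [Nat.pos_iff_ne_zero]
    intro h0
    rw [h0, pow_zero] at hi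
    omega
  have hmin : 9 ^ (i - 1) ≤ C'' * R := by
    have := Nat.find_min hex (show i - 1 < i by omega)
    exact not_lt.mp this
  have hik : 2 ^ k < i := by
    have h1 : 9 ^ (2 ^ k) < 9 ^ i := lt_of_le_of_lt (hR.trans hCR) hi
    exact (Nat.pow_lt_pow_iff_right (by norm_num)).mp h1
  -- the 2-adic logarithm of `9^i`
  have hx4 : (4 : ℤ) ∣ ((9 ^ i : ℕ) : ℤ) - 1 := by
    have h := sub_dvd_pow_sub_pow (9 : ℤ) 1 i
    rw [one_pow] at h
    push_cast
    exact dvd_trans ⟨2, by norm_num⟩ h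
  obtain ⟨e, he, hdvd⟩ := exists_pow_five_of_four_dvd hx4 k
  -- the triple `(5^e, 9^i − 5^e, 9^i)`
  have halt : 5 ^ e < 9 ^ i :=
    calc 5 ^ e < 5 ^ (2 ^ k) := Nat.pow_lt_pow_right (by norm_num) he
      _ ≤ 9 ^ (2 ^ k) := Nat.pow_le_pow_left (by norm_num) _
      _ < 9 ^ i := Nat.pow_lt_pow_right (by norm_num) hik
  set b : ℕ := 9 ^ i - 5 ^ e with hb
  have hb0 : 0 < b := by rw [hb]; omega
  have hbdvd : 2 ^ (k + 2) ∣ b := by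
    have h1 : ((b : ℕ) : ℤ) = ((9 ^ i : ℕ) : ℤ) - 5 ^ e := by
      rw [hb, Nat.cast_sub halt.le]; push_cast; ring
    have h2 : ((2 ^ (k + 2) : ℕ) : ℤ) ∣ (b : ℤ) := by rw [h1]; exact_mod_cast hdvd
    exact Int.natCast_dvd_natCast.mp h2
  have habc : IsABCTriple (5 ^ e) b (9 ^ i) := by
    refine ⟨pow_pos (by norm_num) e, hb0, by rw [hb]; omega, ?_⟩
    have hcop : Nat.Coprime (5 ^ e) (9 ^ i) := Nat.Coprime.pow e i (by norm_num)
    rw [hb]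
    exact (Nat.coprime_sub_self_right halt.le).mpr hcop
  refine ⟨5 ^ e, b, 9 ^ i, habc, ?_, ?_⟩
  · -- `rad ≤ R`
    have h1 : rad (5 ^ e) b (9 ^ i) * 2 ^ (k + 2) ≤ 30 * b := by
      rw [rad_def]; exact radical_triple_le hb0 hbdvd
    have h2 : b < 9 ^ i := by
      rw [hb]; exact Nat.sub_lt (pow_pos (by norm_num) i) (pow_pos (by norm_num) e)
    have h3 : 9 ^ i = 9 * 9 ^ (i - 1) := by
      rw [← pow_succ']; congr 1; omega
    have h4 : rad (5 ^ e) b (9 ^ i) * 2 ^ (k + 2) < R * 2 ^ (k + 2) := by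
      calc rad (5 ^ e) b (9 ^ i) * 2 ^ (k + 2) ≤ 30 * b := h1
        _ < 30 * 9 ^ i := Nat.mul_lt_mul_of_pos_left h2 (by norm_num)
        _ = 270 * 9 ^ (i - 1) := by rw [h3]; ring
        _ ≤ 270 * (C'' * R) := Nat.mul_le_mul_left _ hmin
        _ = (270 * C'') * R := by ring
        _ ≤ 2 ^ (k + 2) * R := Nat.mul_le_mul_right _ hk2
        _ = R * 2 ^ (k + 2) := by ring
    exact (Nat.lt_of_mul_lt_mul_right h4).le
  · -- `C R < c`
    have h1 : ((C'' * R : ℕ) : ℝ) < ((9 ^ i : ℕ) : ℝ) := by exact_mod_cast hi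
    push_cast at h1 ⊢
    have hR0 : (0 : ℝ) ≤ R := Nat.cast_nonneg R
    nlinarith

/-- **No linearly good scales, even sparsely (`δ = 0` in conjunct 2 of the crux is false with every
constant and along every sequence of scales).** There is no real `C` such that for every `N` some scale
`R ≥ N` has `c ≤ C·R` for all abc triples of radical `≤ R`. -/
theorem not_sparseGoodScales_exponent_one :
    ¬ ∃ C : ℝ, ∀ N : ℕ, ∃ R : ℕ, N ≤ R ∧
      ∀ a b c : ℕ, IsABCTriple a b c → rad a b c ≤ R → (c : ℝ) ≤ C * R := by
  rintro ⟨C, hC⟩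
  obtain ⟨N, hN⟩ := exists_triple_linear_excess C
  obtain ⟨R, hNR, hR⟩ := hC N
  obtain ⟨a, b, c, habc, hrad, hlt⟩ := hN R hNR
  exact absurd (hR a b c habc hrad) (not_le.mpr hlt)

/-- The same with the exponent written as in `SparseGoodScales` at `δ = 0` (`R^{1+0} = R`, any
constant `C ≥ 0` in front being covered by `not_sparseGoodScales_exponent_one`). -/
theorem not_sparseGoodScales_delta_zero :
    ¬ ∀ N : ℕ, ∃ R : ℕ, N ≤ R ∧
      ∀ a b c : ℕ, IsABCTriple a b c → rad a b c ≤ R → (c : ℝ) ≤ (R : ℝ) ^ ((1 : ℝ) + 0) := by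
  intro h
  apply not_sparseGoodScales_exponent_one
  refine ⟨1, fun N => ?_⟩
  obtain ⟨R, hNR, hR⟩ := h N
  refine ⟨R, hNR, fun a b c habc hrad => ?_⟩
  have := hR a b c habc hrad
  rwa [add_zero, Real.rpow_one, ← one_mul (R : ℝ)] at this

end Summit.ABC.ABC.Theorems.Target.Negative
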